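import Summits.BirchSwinnertonDyer.Rank1Residual.Additive.X3BranchDegenerateEndStateLayerClasses
import Summits.BirchSwinnertonDyer.Rank1Residual.Additive.X3BranchResidualLineH1LayerLowerBound
import HarnessLib

/-!
# X3, the DEGENERATE rows at `p = 3`, rank `0`, OFF the sub-locus: `BSD₃` from EXHIBITED classes with BOTH
# sides taken over the FIRST LAYER `ℚ_1 = ℚ(ζ₉)⁺` — the U-side layer units of gen 7 AND the T-side
# layer Kummer classes of gens 7–8 (cell `bsd-eis`, seat `bsd-eis-x3` gen 8; sequel of
# `X3BranchDegenerateEndStateLayerClasses.lean` with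
# `X3Branch.pow_card_le_natCard_residualLineH1_of_trivialLine_layerOne` in place of gen 6's T-side
# bound; route K1 `AdditiveBranchIMC`, crux `GordTwoRankZeroOffCaseOne` — supports only)

HONEST FRAMING (FULL-BSD rank-`≤ 1` programme D-0033, cell `bsd-eis`): nothing is booked and no label
moves here; THEOREMS ONLY. The end state
`ClassX3Gord.bsdp_three_rankZero_degenerate_of_facts_of_torsionFact_of_cardGe` (gen 6) with its
lower bound `3^{n+Σδ+1} ≤ #H¹(ℚ_Σ/ℚ_∞, Φ₀)·#U(W[3]/Φ₀)` DISCHARGED by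
* the T-side: conductor-`ℓ` characters (`ℓ ∈ T`) and `J` layer-one twisted Kummer classes (three per
  `ℓ ≡ 1 (mod 9)` with `s_ℓ = 3`), independent by the cubic-residue certificate in `ℤ[ζ₉]`
  (`3^{#T + #J} ≤ #H¹`), and
* the U-side: `ι` layer-one units with their certificate (`3^{#ι} ≤ #U`),
under `n + Σδ + 1 ≤ #T + #J + #ι` — Greenberg–Vatsal's full count on every row whose `s_ℓ ≤ 3`
(the `needs_T_layer1` rows: 236 of the 596 off-locus rank-`0` classes at `p = 3`, 13 of them open at
referee A's state R738). [cite: GreenbergVatsal2000, §2 pp. 26–30] [cite: GreenbergLNM1716, §3 p. 86]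
[cite: Delbourgo1998, Prop. 4] [cite: Wuthrich2014, Thm. 16]
-/

set_option autoImplicit false

noncomputable section

open scoped Classical

namespace Summit.BirchSwinnertonDyer.Rank1Residual.Additive

open WeierstrassCurve NumberField IsDedekindDomain Field
  Literature.NumberTheory.EllipticCurves
  Literature.NumberTheory.EllipticCurves.ModularForms
  Literature.NumberTheory.EllipticCurves.GreenbergSelmer
  Literature.NumberTheory.EllipticCurves.GreenbergVatsal2000
  Literature.NumberTheory.EllipticCurves.Rank1Residual
  Literature.NumberTheory.EllipticCurves.Rank1Residual.Typed
  Literature.NumberTheory.GaloisRepresentations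
  Summit.BirchSwinnertonDyer.Rank1Residual.X1.MuLambda
  Summit.BirchSwinnertonDyer.Rank1Residual.AdditivePotMult
  Summit.BirchSwinnertonDyer.Rank1Residual.Additive.X3Branch

/-- **`BSD₃(W)` on the DEGENERATE X3♯(G-ord, `e = 2`) rows of rank `0` from EXHIBITED classes, both sides
over the first layer `ℚ_1`.** As gen 7's
`ClassX3Gord.bsdp_three_rankZero_degenerate_of_facts_of_torsionFact_of_layerClasses`, with the T-side
count strengthened by the `J` layer-one twisted Kummer classes of
`X3Branch.pow_card_le_natCard_residualLineH1_of_trivialLine_layerOne` (radicands `bⱼ ∈ ℤ[ζ₉]` with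
`bⱼ b'ⱼ = nⱼ`, `c(bⱼ) bⱼ = Eⱼ(θ)³`, no `ℓ ∈ T` dividing an `nⱼ`, and their cubic-residue certificate at
primes `q ≡ 1 (mod 27)`), under `n + Σ_{v∈Σ₀} δ_v + 1 ≤ #T + #J + #ι`.
[cite: GreenbergVatsal2000, §2 pp. 26–30] [cite: GreenbergLNM1716, §3 p. 86]
[cite: Delbourgo1998, Prop. 4] [cite: Wuthrich2014, Thm. 16] -/
theorem ClassX3Gord.bsdp_three_rankZero_degenerate_of_facts_of_torsionFact_of_layerClassesT
    [Fact (Nat.Prime 3)] {W : WeierstrassCurve ℚ} [W.IsElliptic] [W.IsGloballyMinimal]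
    (hTors : Greenberg1999.finite_torsion_cyclotomicZpExtension)
    (hDelG : Delbourgo1998.prop4_rankZero_constantCoeff_eq_unit_mul_of_potGoodOrd)
    (hDel98 : Delbourgo1998.prop4_rankZero_pow_dvd_constantCoeff)
    (hGZK : rank_eq_analyticRank_of_analyticRank_le_one) (hmod : hasEntireLFunction_rat)
    (hmodD : nonempty_modularParametrizationData)
    (hW16 : Wuthrich2014.thm16_halfEigenCharIdeal_dvd_cyclotomicPrime)
    (h23 : datumSelmer_nonPrimitive_invariants)
    (hRQ : datumSelmer_divisible_of_finite_torsionBy_of_gr_inertiaInvariants_eq_zero)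
    (hGrK : Greenberg1999.imKummer_ge_strictCondition_goodOrdinary)
    (hLiftE : residualEpsilon_surjOn_of_lineEven)
    (hX : ClassX3Gord W 3) (hr : W.analyticRank = 0)
    (S₀ : Finset (HeightOneSpectrum (𝓞 ℚ))) (hne : S₀.Nonempty)
    (hS₀ : ∀ v ∈ S₀, (((3 : ℕ) : ℕ) : 𝓞 ℚ) ∉ v.asIdeal)
    (hS : ∀ v : HeightOneSpectrum (𝓞 ℚ), v ∉ S₀ → (((3 : ℕ) : ℕ) : 𝓞 ℚ) ∉ v.asIdeal →
      W.HasGoodReductionAt v)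
    (Φ₀ : AddSubgroup (W.geomTorsion ((3 : ℕ) : ℤ))) (hΦ : IsRationalLine W 3 Φ₀)
    (htriv : ∀ (σ : absoluteGaloisGroup ℚ) (Pt : geomTorsion W ((3 : ℕ) : ℤ)), Pt ∈ Φ₀ → σ • Pt = Pt)
    {n : ℕ}
    (hcert : ∀ (V : WeierstrassCurve ℚ) [V.IsElliptic] [V.IsGloballyMinimal] (C : VariableChange ℚ),
      C • V.quadraticTwist ((-1) ^ ((3 : ℕ) / 2) * (3 : ℕ) : ℚ) = W → X3BranchUnitCoeffCertAt V 3 n)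
    -- T-side, conductor-`ℓ` characters (gen 6)
    (T : Finset ℕ) (hT : ∀ ℓ ∈ T, ℓ.Prime ∧ 3 ∣ ℓ - 1 ∧ ∃ v ∈ S₀, ((ℓ : ℕ) : 𝓞 ℚ) ∈ v.asIdeal)
    {ζ : AlgebraicClosure ℚ} (hζ : IsPrimitiveRoot ζ 9)
    -- U-side over `ℚ_1` (gen 7)
    {ι : Type} [Fintype ι] [DecidableEq ι] (P : ι → Fin 3 → Fin 3 → ℤ)
    (hconj1 : ∀ i, (P i 0 0 : AlgebraicClosure ℚ) + P i 0 1 * ((ζ + ζ ^ 8) ^ 2 - 2) +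
      P i 0 2 * ((ζ + ζ ^ 8) ^ 2 - 2) ^ 2 =
      (P i 1 0 : AlgebraicClosure ℚ) + P i 1 1 * (ζ + ζ ^ 8) + P i 1 2 * (ζ + ζ ^ 8) ^ 2)
    (hconj2 : ∀ i, (P i 0 0 : AlgebraicClosure ℚ) + P i 0 1 * (-(ζ + ζ ^ 8) ^ 2 - (ζ + ζ ^ 8) + 2) +
      P i 0 2 * (-(ζ + ζ ^ 8) ^ 2 - (ζ + ζ ^ 8) + 2) ^ 2 =
      (P i 2 0 : AlgebraicClosure ℚ) + P i 2 1 * (ζ + ζ ^ 8) + P i 2 2 * (ζ + ζ ^ 8) ^ 2)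
    (D Tc : ι → Fin 3 → Fin 3 → ℤ)
    (hcube : ∀ i j, ((P i j 0 : AlgebraicClosure ℚ) + P i j 1 * (ζ + ζ ^ 8) + P i j 2 * (ζ + ζ ^ 8) ^ 2) *
      ((D i j 0 : AlgebraicClosure ℚ) + D i j 1 * (ζ + ζ ^ 8) + D i j 2 * (ζ + ζ ^ 8) ^ 2) ^ 3 =
      1 + 9 * ((Tc i j 0 : AlgebraicClosure ℚ) + Tc i j 1 * (ζ + ζ ^ 8) + Tc i j 2 * (ζ + ζ ^ 8) ^ 2))
    (nm : ι → ℕ) (hn0 : ∀ i, nm i ≠ 0)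
    (hnorm : ∀ i, ((P i 0 0 : AlgebraicClosure ℚ) + P i 0 1 * (ζ + ζ ^ 8) + P i 0 2 * (ζ + ζ ^ 8) ^ 2) *
      (((P i 1 0 : AlgebraicClosure ℚ) + P i 1 1 * (ζ + ζ ^ 8) + P i 1 2 * (ζ + ζ ^ 8) ^ 2) *
        ((P i 2 0 : AlgebraicClosure ℚ) + P i 2 1 * (ζ + ζ ^ 8) + P i 2 2 * (ζ + ζ ^ 8) ^ 2)) = nm i)
    (hnS : ∀ i (v : HeightOneSpectrum (𝓞 ℚ)), ((nm i : ℕ) : 𝓞 ℚ) ∈ v.asIdeal → v ∈ S₀)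
    {R : ℕ} (q : Fin R → ℕ) (hq : ∀ ρ, (q ρ).Prime) (hq1 : ∀ ρ, 3 ∣ q ρ - 1)
    (r : (ρ : Fin R) → Fin 3 → ZMod (q ρ)) (hrr : ∀ ρ kk, r ρ kk ^ 3 - 3 * r ρ kk + 1 = 0)
    (w : (ρ : Fin R) → Fin 3 → Fin 3 → ZMod (q ρ))
    (hw : ∀ ρ (c c' : Fin 3), ∑ kk, w ρ c kk * r ρ kk ^ c'.val = if c = c' then 1 else 0)
    (ω : (ρ : Fin R) → ZMod (q ρ)) (hω : ∀ ρ, ω ρ ^ 3 = 1 ∧ ω ρ ≠ 1)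
    (e : Fin R → ι → ℕ)
    (he : ∀ ρ i, ((P i 0 0 : ZMod (q ρ)) + (P i 0 1 : ZMod (q ρ)) * r ρ 0 +
      (P i 0 2 : ZMod (q ρ)) * r ρ 0 ^ 2) ^ ((q ρ - 1) / 3) = ω ρ ^ e ρ i)
    (hnz : ∀ ρ i, (P i 0 0 : ZMod (q ρ)) + (P i 0 1 : ZMod (q ρ)) * r ρ 0 +
      (P i 0 2 : ZMod (q ρ)) * r ρ 0 ^ 2 ≠ 0)
    (L : ι → Fin R → ℤ)
    (hL : ∀ i i', (∑ ρ, (L i ρ : ZMod 3) * (e ρ i' : ZMod 3)) = if i = i' then 1 else 0)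
    -- T-side over `ℚ_1` (gens 7–8): the layer Kummer classes
    {J : Type} [Fintype J] [DecidableEq J]
    (b b' : J → Fin 6 → ℤ) (E : J → Fin 3 → ℤ) (nT : J → ℕ) (hnT0 : ∀ j, nT j ≠ 0)
    (hnT : ∀ j, (∑ k : Fin 6, (b j k : AlgebraicClosure ℚ) * ζ ^ (k : ℕ)) *
      (∑ k : Fin 6, (b' j k : AlgebraicClosure ℚ) * ζ ^ (k : ℕ)) = (nT j : AlgebraicClosure ℚ))
    (hnTS : ∀ j (v : HeightOneSpectrum (𝓞 ℚ)), ((nT j : ℕ) : 𝓞 ℚ) ∈ v.asIdeal → v ∈ S₀)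
    (hflipT : ∀ j, (∑ k : Fin 6, (b j k : AlgebraicClosure ℚ) * (ζ ^ 8) ^ (k : ℕ)) *
      (∑ k : Fin 6, (b j k : AlgebraicClosure ℚ) * ζ ^ (k : ℕ)) =
      ((E j 0 : AlgebraicClosure ℚ) + E j 1 * (ζ + ζ ^ 8) + E j 2 * (ζ + ζ ^ 8) ^ 2) ^ 3)
    (hTn : ∀ ℓ ∈ T, ∀ j, ¬ ℓ ∣ nT j)
    {R' : ℕ} (q' : Fin R' → ℕ) (hq' : ∀ ρ, (q' ρ).Prime) (hq27 : ∀ ρ, 27 ∣ q' ρ - 1)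
    (r' : (ρ : Fin R') → Fin 6 → ZMod (q' ρ)) (hr' : ∀ ρ k, r' ρ k ^ 6 + r' ρ k ^ 3 + 1 = 0)
    (w' : (ρ : Fin R') → Fin 6 → Fin 6 → ZMod (q' ρ))
    (hw' : ∀ ρ (a a' : Fin 6), ∑ k, w' ρ a k * r' ρ k ^ a'.val = if a = a' then 1 else 0)
    (ω' : (ρ : Fin R') → ZMod (q' ρ)) (hω' : ∀ ρ, ω' ρ ^ 3 = 1 ∧ ω' ρ ≠ 1)
    (e' : Fin R' → J → ℕ)
    (he' : ∀ ρ j, (∑ k : Fin 6, (b j k : ZMod (q' ρ)) * r' ρ 0 ^ (k : ℕ)) ^ ((q' ρ - 1) / 3) =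
      ω' ρ ^ e' ρ j)
    (hnz' : ∀ ρ j, (∑ k : Fin 6, (b j k : ZMod (q' ρ)) * r' ρ 0 ^ (k : ℕ)) ≠ 0)
    (L' : J → Fin R' → ℤ)
    (hL' : ∀ j j', (∑ ρ, (L' j ρ : ZMod 3) * (e' ρ j' : ZMod 3)) = if j = j' then 1 else 0)
    (hcount : n + ∑ v ∈ S₀, delta W 3 v + 1 ≤ T.card + Fintype.card J + Fintype.card ι) :
    BSDp W 3 := by
  refine ClassX3Gord.bsdp_three_rankZero_degenerate_of_facts_of_torsionFact_of_cardGe hTors hDelG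
    hDel98 hGZK hmod hmodD hW16 h23 hRQ hGrK hLiftE hX hr S₀ hne hS₀ hS Φ₀ hΦ htriv hcert
    fun κ hκ hH hU ↦ ?_
  haveI := hH
  haveI := hU
  calc 3 ^ (n + ∑ v ∈ S₀, delta W 3 v + 1) ≤ 3 ^ (T.card + Fintype.card J + Fintype.card ι) :=
        Nat.pow_le_pow_right (by norm_num) hcount
    _ = 3 ^ (T.card + Fintype.card J) * 3 ^ Fintype.card ι := pow_add _ _ _
    _ ≤ Nat.card (residualLineH1 W 3 κ S₀ Φ₀ hΦ) * Nat.card (residualQuotSelmer W 3 κ S₀ Φ₀ hΦ) :=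
        Nat.mul_le_mul
          (X3Branch.pow_card_le_natCard_residualLineH1_of_trivialLine_layerOne κ hκ S₀ hS₀ hΦ htriv T hT
            hζ b b' E nT hnT0 hnT hnTS hflipT hTn q' hq' hq27 r' hr' w' hw' ω' hω' e' he' hnz' L' hL')
          (X3Branch.pow_card_le_natCard_residualQuotSelmer_of_trivialLine_layerOne κ hκ S₀ hΦ htriv hζ
            P hconj1 hconj2 D Tc hcube nm hn0 hnorm hnS q hq hq1 r hrr w hw ω hω e he hnz L hL)

end Summit.BirchSwinnertonDyer.Rank1Residual.Additive

end
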